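import Summits.BirchSwinnertonDyer.BirchSwinnertonDyer.Theorems.ErratumRoadFiveSelmerDefectGenerators
import HarnessLib

/-!
# Route `ErratumRoadFive` (K2, `p ≥ 5`), crux (T) `Rest3TorsionBranchAtFive` (item
# stmt-BirchSwinnertonDyer-19702): the control defect of THEOREM T♭ with MIXED constrained places — a
# bounded place `v₀` (`H⁰(K_𝔭, M)` finite, killed by `π^k`) together with DIVISIBLE places (the inertia
# indices of the Literature currency `BigGaloisRepSelmer.strictSet`, where `H⁰(I_w, M) = M` is divisible)

Cell `bsd-stepL` (run/shared/lean/pub/bsd-stepL/), seat `bsd-stepL-bdp` (prover g15, 2026-08-27), memo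
`HOME/proof/PROOF-BDP.md` §31.2, §33.10; `--supports stmt-BirchSwinnertonDyer-19702 --as helper`.

WHY. g14's control-defect lemmas (`SelmerControlDefect`, p469612; `SelmerDefectGenerators`, p475110) treat the
erratum's own currency `Sel^Σ_𝔭(K, M) = ker{H¹(G_{K,S}, M) → H¹(K_𝔭, M)}` — ONE constrained place, the
unramified conditions outside `S` being carried by `Γ = G_{K,S}`. The Literature currency that the road's
instantiation uses (`Literature/…/BigGaloisRepSelmer.lean`, defn-ty1 p478886: `selmerBig κ ρ 𝔮 Σ =
selmer (localMap K) (strictSet p 𝔮 Σ) …`) takes `Γ = Γ_K` and imposes unramifiedness at `w ∉ Σ` through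
INERTIA indices in the constrained set, where the local invariants are ALL of `M` — not killed by `π^k`, but
`a`-DIVISIBLE, so that the control defect there VANISHES (erratum Lemma 2.1: «the kernel of the second
arrow is `H⁰/ϖ^m H⁰`»). This file proves the mixed form: the defect is killed by `a` as soon as
`a·M^{Γ_v} ⊆ r·M^{Γ_v}` at EVERY constrained `v` (§1) — which holds both at a bounded place (`a·M^{Γ_v} = 0`)
and at a divisible one (`r·M^{Γ_v} = M^{Γ_v}`) —, and the generator bound (G2) `#defect ≤ #M^{Γ_{v₀}}`
survives when every constrained `v ≠ v₀` is divisible (§2).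

HONEST FRAMING: theorems only (no definition, no named fact, no `sorry`); PURE ALGEBRA on abstract Selmer
data; nothing is booked; no census word, tier or label moves (T7).
References: [Castella2018Erratum] Lemma 2.1 (p. 2); [Castella2018] Def. 2.1–2.2; memo PROOF-BDP §31.2.
-/

set_option autoImplicit false
-- the Theorems namespace of this sub repeats the summit name by design (D-0017 nested layout)
set_option linter.dupNamespace false

noncomputable section

open CategoryTheory CharacterModule Literature.NumberTheory.GaloisRepresentations
  Literature.RingTheory.FittingIdeal Literature.NumberTheory.EllipticCurves
  Literature.NumberTheory.EllipticCurves.Module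
  Summit.BirchSwinnertonDyer.Rank1Residual.X11b.TorsionControl
  Summit.BirchSwinnertonDyer.Rank1Residual.X11b
  Summit.BirchSwinnertonDyer.BirchSwinnertonDyer.Theorems.SelmerControlDefect
  Summit.BirchSwinnertonDyer.BirchSwinnertonDyer.Theorems.SelmerDefectGenerators
open scoped ContRepresentation

namespace Summit.BirchSwinnertonDyer.BirchSwinnertonDyer.Theorems.SelmerDefectMixedPlaces

universe u

variable {A : Type*} [CommRing A] [TopologicalSpace A]
variable {Γ : Type u} [Group Γ] [TopologicalSpace Γ] [IsTopologicalGroup Γ]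
variable {M : Type u} [AddCommGroup M] [Module A M] [TopologicalSpace M] [DiscreteTopology M]
  [ContinuousSMul A M]
variable {ι : Type*} {Γv : ι → Type u} [∀ v, Group (Γv v)] [∀ v, TopologicalSpace (Γv v)]
  [∀ v, IsTopologicalGroup (Γv v)] (φ : ∀ v, Γv v →ₜ* Γ) (L : Set ι)
variable (ρ : ContinuousRep Γ A M) (r : A)

/-! ### §1 The exponent of the control defect with mixed constrained places -/

/-- **`a · (Sel(M) ∩ H¹(Γ, M)[r]) ⊆ H¹(ι)(Sel(M[r]))` as soon as `a·M^{Γ_v} ⊆ r·M^{Γ_v}` at every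
constrained `v`** (no global hypothesis). Covers at once the BOUNDED places (`a·M^{Γ_v} = 0`: T♭'s
`H⁰(K_𝔭, M_E)` killed by `p^k`) and the DIVISIBLE ones (`r·M^{Γ_v} = M^{Γ_v}`: the inertia indices
`H⁰(I_w, M) = M`, or the erratum's (iv)). Proof: lift with defect witnesses `w_v`, then
`res_v(a·x) = δ₀(a·w_v) = δ₀(r·w'_v) = 0`. [cite: Castella2018Erratum, Lemma 2.1 and Remark (2) (p. 2)] -/
theorem smul_mem_map_selmer_of_local (hr : Function.Surjective fun m : M => r • m) (a : A)
    (ha : ∀ v ∈ L, ∀ w : M, w ∈ ((ρ.restrict (φ v)).toTopRep).ρ.invariants →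
      ∃ w' ∈ ((ρ.restrict (φ v)).toTopRep).ρ.invariants, r • w' = a • w)
    {y : continuousCohomology 1 ρ.toTopRep} (hy : y ∈ selmer φ L ρ) (hry : r • y = 0) :
    a • y ∈ Submodule.map (torsionInclH1 ρ r) (selmer φ L (torsionRep ρ r)) := by
  obtain ⟨x, hx, hloc⟩ := exists_lift_with_local_defect φ L ρ r hr hy hry
  refine ⟨a • x, (mem_selmer_iff φ L (torsionRep ρ r) _).mpr fun v hv => ?_, by rw [map_smul, hx]⟩
  obtain ⟨w, hw⟩ := hloc v hv
  obtain ⟨w', hw', hrw⟩ := ha v hv w.1 w.2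
  have haw : (isSES_torsion (ρ.restrict (φ v)) r hr).δ₀ (a • w) = 0 :=
    ((isSES_torsion (ρ.restrict (φ v)) r hr).δ₀_eq_zero_iff (a • w)).mpr ⟨w', hw', hrw⟩
  have h1 : resH1 (torsionRep ρ r) (φ v) (a • x) = a • resH1 (torsionRep ρ r) (φ v) x := map_smul _ _ _
  have h2 : a • (isSES_torsion (ρ.restrict (φ v)) r hr).δ₀ w = 0 := by rw [← map_smul, haw]
  have h3 : a • resH1 (torsionRep ρ r) (φ v) x = a • (isSES_torsion (ρ.restrict (φ v)) r hr).δ₀ w :=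
    congrArg (fun z => a • z) hw.symm
  exact h1.trans (h3.trans h2)

/-- **Powers**: for `r = b^m`, if `b` acts surjectively on `M` and at every constrained `v` either `a`
KILLS `M^{Γ_v}` or `M^{Γ_v}` is `b`-DIVISIBLE, then `a · (Sel(M) ∩ H¹[b^m]) ⊆ H¹(ι_m)(Sel(M[b^m]))` for
EVERY `m`. [cite: Castella2018Erratum, Lemma 2.1 and Remark (2) (p. 2)] -/
theorem smul_mem_map_selmer_pow_of_local (b : A) (hb : Function.Surjective fun m : M => b • m) (a : A)
    (ha : ∀ v ∈ L, (∀ w : M, w ∈ ((ρ.restrict (φ v)).toTopRep).ρ.invariants → a • w = 0) ∨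
      (∀ w : M, w ∈ ((ρ.restrict (φ v)).toTopRep).ρ.invariants →
        ∃ w' ∈ ((ρ.restrict (φ v)).toTopRep).ρ.invariants, b • w' = w))
    (m : ℕ) {y : continuousCohomology 1 ρ.toTopRep} (hy : y ∈ selmer φ L ρ) (hry : b ^ m • y = 0) :
    a • y ∈ Submodule.map (torsionInclH1 ρ (b ^ m)) (selmer φ L (torsionRep ρ (b ^ m))) := by
  refine smul_mem_map_selmer_of_local φ L ρ (b ^ m) (pow_smul_surjective b hb m) a
    (fun v hv w hw => ?_) hy hry
  rcases ha v hv with hkill | hdiv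
  · exact ⟨0, Submodule.zero_mem _, by rw [hkill w hw, smul_zero]⟩
  · -- `b`-divisible invariants are `b^m`-divisible
    have hpow : ∀ n : ℕ, ∀ w : M, w ∈ ((ρ.restrict (φ v)).toTopRep).ρ.invariants →
        ∃ w' ∈ ((ρ.restrict (φ v)).toTopRep).ρ.invariants, b ^ n • w' = w := by
      intro n
      induction n with
      | zero => intro w hw; exact ⟨w, hw, by rw [pow_zero, one_smul]⟩
      | succ n ih =>
        intro w hw
        obtain ⟨w₁, hw₁, h₁⟩ := hdiv w hw
        obtain ⟨w₂, hw₂, h₂⟩ := ih w₁ hw₁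
        exact ⟨w₂, hw₂, by rw [pow_succ', mul_smul, h₂, h₁]⟩
    obtain ⟨w', hw', h'⟩ := hpow m (a • w) (Submodule.smul_mem _ a hw)
    exact ⟨w', hw', h'⟩

/-! ### §2 (G2) with mixed places: `#defect ≤ #M^{Γ_{v₀}}` when every other constrained place is divisible -/

/-- **`#(Sel(M)[r] / j(Sel(M[r]))) ≤ #M^{Γ_{v₀}}` and the defect is finite — constrained set `L ∋ v₀` with
`M^{Γ_v}` `r`-DIVISIBLE at every `v ∈ L`, `v ≠ v₀`**, for `r`-divisible `M` with vanishing global invariants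
and finite `M^{Γ_{v₀}}`. As in `SelmerDefectGenerators.natCard_defect_le` (single place), the canonical map
`s ↦ res_{v₀}(x(s))` kills exactly `j(Sel(M[r]))` — because at the divisible places the local condition on
the unique lift `x(s)` is AUTOMATIC (`res_v x = δ₀(w_v)`, `w_v ∈ M^{Γ_v} = r·M^{Γ_v}`) — and lands in
`im δ₀^{(v₀)}`. [cite: Castella2018Erratum, Lemma 2.1] -/
theorem natCard_defect_le_mixed (v₀ : ι) (hv₀ : v₀ ∈ L) (hr : Function.Surjective fun m : M => r • m)
    (h0 : ρ.toTopRep.ρ.invariants = ⊥)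
    (hdivL : ∀ v ∈ L, v ≠ v₀ → ∀ w : M, w ∈ ((ρ.restrict (φ v)).toTopRep).ρ.invariants →
      ∃ w' ∈ ((ρ.restrict (φ v)).toTopRep).ρ.invariants, r • w' = w)
    [Finite ((ρ.restrict (φ v₀)).toTopRep).ρ.invariants] :
    Finite (↥(Submodule.torsionBy A ↥(selmer φ L ρ) r) ⧸
        Submodule.comap ((selmer φ L ρ).subtype ∘ₗ (Submodule.torsionBy A ↥(selmer φ L ρ) r).subtype)
          (Submodule.map (torsionInclH1 ρ r) (selmer φ L (torsionRep ρ r)))) ∧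
      Nat.card (↥(Submodule.torsionBy A ↥(selmer φ L ρ) r) ⧸
        Submodule.comap ((selmer φ L ρ).subtype ∘ₗ (Submodule.torsionBy A ↥(selmer φ L ρ) r).subtype)
          (Submodule.map (torsionInclH1 ρ r) (selmer φ L (torsionRep ρ r)))) ≤
        Nat.card ((ρ.restrict (φ v₀)).toTopRep).ρ.invariants := by
  have hdiv := invariants_divisible_of_eq_bot ρ r h0
  set S : Submodule A ↥(selmer φ L ρ) := Submodule.torsionBy A ↥(selmer φ L ρ) r with hS
  set U : Submodule A ↥S := Submodule.comap ((selmer φ L ρ).subtype ∘ₗ S.subtype)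
      (Submodule.map (torsionInclH1 ρ r) (selmer φ L (torsionRep ρ r))) with hU
  -- the unique lift `x(s) ∈ H¹(Γ, M[r])` of `s`, linearly in `s`
  let e := torsionH1Equiv ρ r hr hdiv
  let toTors : ↥S →ₗ[A] ↥(Submodule.torsionBy A (continuousCohomology 1 ρ.toTopRep) r) :=
    { toFun := fun s => ⟨((s : ↥(selmer φ L ρ)) : continuousCohomology 1 ρ.toTopRep),
        (Submodule.mem_torsionBy_iff r _).2
          (congrArg Subtype.val ((Submodule.mem_torsionBy_iff r (s : ↥(selmer φ L ρ))).1 s.2))⟩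
      map_add' := fun _ _ => rfl
      map_smul' := fun _ _ => rfl }
  let lift : ↥S →ₗ[A] continuousCohomology 1 (torsionRep ρ r).toTopRep := e.symm.toLinearMap ∘ₗ toTors
  have hlift : ∀ s : ↥S, torsionInclH1 ρ r (lift s) =
      ((s : ↥(selmer φ L ρ)) : continuousCohomology 1 ρ.toTopRep) := by
    intro s
    have := torsionH1Equiv_apply_coe ρ r hr hdiv (e.symm (toTors s))
    rw [LinearEquiv.apply_symm_apply] at this
    exact this.symm
  -- at a DIVISIBLE constrained place the local condition on the lift is automatic
  have hauto : ∀ s : ↥S, ∀ v ∈ L, v ≠ v₀ → resH1 (torsionRep ρ r) (φ v) (lift s) = 0 := by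
    intro s v hv hne
    obtain ⟨x, hx, hloc⟩ := exists_lift_with_local_defect φ L ρ r hr
      (y := ((s : ↥(selmer φ L ρ)) : continuousCohomology 1 ρ.toTopRep)) (s : ↥(selmer φ L ρ)).2
      (congrArg Subtype.val ((Submodule.mem_torsionBy_iff r (s : ↥(selmer φ L ρ))).1 s.2))
    have hxe : x = lift s :=
      cohomologyMap_torsionIncl_injective ρ r hr hdiv (hx.trans (hlift s).symm)
    obtain ⟨w, hw⟩ := hloc v hv
    rw [hxe] at hw
    exact (res_lift_eq_zero_iff_divisible φ ρ r hr v (lift s) w hw).mpr (hdivL v hv hne w.1 w.2)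
  -- the defect map `g : s ↦ res_{v₀} (x(s))`
  let res : continuousCohomology 1 (torsionRep ρ r).toTopRep →ₗ[A]
      continuousCohomology 1 ((torsionRep ρ r).restrict (φ v₀)).toTopRep :=
    (resH1 (torsionRep ρ r) (φ v₀)).hom.toLinearMap
  let g : ↥S →ₗ[A] continuousCohomology 1 ((torsionRep ρ r).restrict (φ v₀)).toTopRep := res ∘ₗ lift
  -- `g` kills exactly `U`
  have hker : ∀ s : ↥S, g s = 0 ↔ s ∈ U := by
    intro s
    have key := mem_map_selmer_iff_forall_res_eq_zero φ L ρ r hr hdiv (lift s) (hlift s)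
    constructor
    · intro hg
      have hmem := key.mpr (fun v hv => by
        by_cases hne : v = v₀
        · subst hne; exact hg
        · exact hauto s v hv hne)
      exact hmem
    · intro hs
      exact (key.mp hs) v₀ hv₀
  have hUker : U ≤ LinearMap.ker g := fun s hs => (hker s).mpr hs
  let gq : (↥S ⧸ U) →ₗ[A] continuousCohomology 1 ((torsionRep ρ r).restrict (φ v₀)).toTopRep :=
    U.liftQ g hUker
  have hgq_inj : Function.Injective gq := by
    rw [← LinearMap.ker_eq_bot, Submodule.eq_bot_iff]
    intro q hq
    obtain ⟨s, rfl⟩ := Submodule.mkQ_surjective U q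
    rw [LinearMap.mem_ker, Submodule.mkQ_apply, Submodule.liftQ_apply] at hq
    exact (Submodule.Quotient.mk_eq_zero U).mpr ((hker s).mp hq)
  -- `g` lands in the image of `δ₀^{(v₀)} : M^{Γ_{v₀}} → H¹(Γ_{v₀}, M[r])`
  let δ : ↥((ρ.restrict (φ v₀)).toTopRep).ρ.invariants →ₗ[A]
      continuousCohomology 1 ((torsionRep ρ r).restrict (φ v₀)).toTopRep :=
    (isSES_torsion (ρ.restrict (φ v₀)) r hr).δ₀
  have hrange : ∀ s : ↥S, g s ∈ LinearMap.range δ := by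
    intro s
    obtain ⟨x, hx, hloc⟩ := exists_lift_with_local_defect φ L ρ r hr
      (y := ((s : ↥(selmer φ L ρ)) : continuousCohomology 1 ρ.toTopRep)) (s : ↥(selmer φ L ρ)).2
      (congrArg Subtype.val ((Submodule.mem_torsionBy_iff r (s : ↥(selmer φ L ρ))).1 s.2))
    have hxe : x = lift s :=
      cohomologyMap_torsionIncl_injective ρ r hr hdiv (hx.trans (hlift s).symm)
    obtain ⟨w, hw⟩ := hloc v₀ hv₀
    refine ⟨w, ?_⟩
    rw [hxe] at hw
    exact hw
  -- counting
  haveI : Finite ↥(LinearMap.range δ) :=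
    Finite.of_surjective (LinearMap.rangeRestrict δ) (LinearMap.surjective_rangeRestrict δ)
  let gq' : (↥S ⧸ U) → ↥(LinearMap.range δ) := fun q => ⟨gq q, by
    obtain ⟨s, rfl⟩ := Submodule.mkQ_surjective U q
    rw [Submodule.mkQ_apply, Submodule.liftQ_apply]
    exact hrange s⟩
  have hgq'_inj : Function.Injective gq' := fun q q' h => hgq_inj (congrArg Subtype.val h)
  haveI hfin : Finite (↥S ⧸ U) := Finite.of_injective gq' hgq'_inj
  refine ⟨hfin, (Nat.card_le_card_of_injective gq' hgq'_inj).trans ?_⟩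
  exact Nat.card_le_card_of_surjective (LinearMap.rangeRestrict δ) (LinearMap.surjective_rangeRestrict δ)

/-- **(G2), mixed places: the dual defect is spanned by `B` elements** whenever `#M^{Γ_{v₀}} ≤ B`.
[cite: Castella2018Erratum, Lemma 2.1] -/
theorem exists_fin_span_dual_defect_mixed (v₀ : ι) (hv₀ : v₀ ∈ L)
    (hr : Function.Surjective fun m : M => r • m) (h0 : ρ.toTopRep.ρ.invariants = ⊥)
    (hdivL : ∀ v ∈ L, v ≠ v₀ → ∀ w : M, w ∈ ((ρ.restrict (φ v)).toTopRep).ρ.invariants →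
      ∃ w' ∈ ((ρ.restrict (φ v)).toTopRep).ρ.invariants, r • w' = w)
    [Finite ((ρ.restrict (φ v₀)).toTopRep).ρ.invariants] {B : ℕ}
    (hB : Nat.card ((ρ.restrict (φ v₀)).toTopRep).ρ.invariants ≤ B) :
    ∃ κ : Fin B → CharacterModule (↥(Submodule.torsionBy A ↥(selmer φ L ρ) r) ⧸
        Submodule.comap ((selmer φ L ρ).subtype ∘ₗ (Submodule.torsionBy A ↥(selmer φ L ρ) r).subtype)
          (Submodule.map (torsionInclH1 ρ r) (selmer φ L (torsionRep ρ r)))),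
      Submodule.span A (Set.range κ) = ⊤ := by
  obtain ⟨hfin, hcard⟩ := natCard_defect_le_mixed φ L ρ r v₀ hv₀ hr h0 hdivL
  haveI := hfin
  haveI := PontryaginCard.finite_characterModule_of_finite
    (↥(Submodule.torsionBy A ↥(selmer φ L ρ) r) ⧸
      Submodule.comap ((selmer φ L ρ).subtype ∘ₗ (Submodule.torsionBy A ↥(selmer φ L ρ) r).subtype)
        (Submodule.map (torsionInclH1 ρ r) (selmer φ L (torsionRep ρ r))))
  refine exists_fin_span_eq_top_of_natCard_le ?_
  rw [PontryaginCard.natCard_characterModule]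
  exact hcard.trans hB

end Summit.BirchSwinnertonDyer.BirchSwinnertonDyer.Theorems.SelmerDefectMixedPlaces

end
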